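import Summits.HubbardSuperconductivity.HubbardSuperconductivity.Theorems.AnisotropyChordTransferFibre3Symmetry

/-!
# Route `AnisotropyChord` / H0 rotor rung: PORT N30-A proofs, part 3 — plane waves diagonalise the free fibre Hamiltonian

First step of the Krein reduction (memo ROTOR-THEORY-20 §277(a), theory seat `hubbard-h0-rotor-theory-1`, cycle 20): in the
`K` fibre the plane wave `pw k₂ k₃ (a,b) = e^{ik₂·a} e^{ik₃·b}` is an eigenfunction of `H0apply K` with eigenvalue
`ε(K − k₂ − k₃) + ε(k₂) + ε(k₃)` (`ε = epsT`, the magnon dispersion), i.e. exactly the free three-body energy entering `den`: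
* `phase_add_left`, `phase_neg_left` (bilinearity of the character in the momentum), `phase_ex_add_conj`/`phase_ey_add_conj`
  (`e^{iq·eₓ} + e^{−iq·eₓ} = 2cos(2π qₓ/L)`), `sum_phase_nn` (`Σ_{e=±eₓ,±e_y} e^{iq·e} = 2(2 − ε(q))`... as `4 − 2ε(q)`);
* **`H0apply_pw`** : `H0apply K (pw k₂ k₃) = (epsT (K − k₂ − k₃) + epsT k₂ + epsT k₃) • pw k₂ k₃`.
Prover seat `hubbard-h0-rotor-p1` g21; helper for stmt-HubbardSuperconductivity-19089 (`--supports`).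
-/

set_option linter.dupNamespace false
set_option autoImplicit false

noncomputable section

open scoped BigOperators
open Complex

namespace Summit.HubbardSuperconductivity.HubbardSuperconductivity.Theorems.AnisotropyChord.Transfer.Fibre3

variable (L : ℕ) [NeZero L]

/-! ## Bilinearity of the character in the momentum -/

/-- `phase (K + K') r = phase K r · phase K' r`. [folklore] -/
theorem phase_add_left (K K' r : Tor L) : phase L (K + K') r = phase L K r * phase L K' r := by
  rw [phase_eq_phZ, phase_eq_phZ, phase_eq_phZ, ← phZ_add]
  congr 1; unfold dotZ; simp only [Prod.fst_add, Prod.snd_add]; ring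

/-- `phase (−K) r = phase K (−r)`. [folklore] -/
theorem phase_neg_left (K r : Tor L) : phase L (-K) r = phase L K (-r) := by
  rw [phase_eq_phZ, phase_eq_phZ]
  congr 1; unfold dotZ; simp only [Prod.fst_neg, Prod.snd_neg]; ring

/-- `phase (K − K') r · phase K' r = phase K r`. [folklore] -/
theorem phase_sub_left_mul (K K' r : Tor L) : phase L (K - K') r * phase L K' r = phase L K r := by
  rw [← phase_add_left, sub_add_cancel]

/-- `phase q eₓ = exp(2πi·val(q₁)/L)`. [folklore] -/
theorem phase_ex (q : Tor L) :
    phase L q (ex L) = Complex.exp (2 * Real.pi * Complex.I * (((q.1.val : ℕ) : ℂ) / (L : ℂ))) := by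
  rw [phase_eq_phZ]; unfold dotZ ex phZ; simp

/-- `phase q e_y = exp(2πi·val(q₂)/L)`. [folklore] -/
theorem phase_ey (q : Tor L) :
    phase L q (ey L) = Complex.exp (2 * Real.pi * Complex.I * (((q.2.val : ℕ) : ℂ) / (L : ℂ))) := by
  rw [phase_eq_phZ]; unfold dotZ ey phZ; simp

omit [NeZero L] in
/-- `exp(iθ) + conj exp(iθ) = 2cos θ` for `θ = 2πn/L`. [folklore] -/
theorem exp_add_conj_eq_two_cos (n : ℕ) :
    Complex.exp (2 * Real.pi * Complex.I * (((n : ℕ) : ℂ) / (L : ℂ)))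
      + (starRingEnd ℂ) (Complex.exp (2 * Real.pi * Complex.I * (((n : ℕ) : ℂ) / (L : ℂ))))
      = ((2 * Real.cos (2 * Real.pi * n / L) : ℝ) : ℂ) := by
  rw [Complex.add_conj]
  congr 1
  rw [Complex.exp_re]
  have hre : (2 * (Real.pi : ℂ) * Complex.I * (((n : ℕ) : ℂ) / (L : ℂ))).re = 0 := by
    simp [Complex.mul_re, Complex.div_re]
  have him : (2 * (Real.pi : ℂ) * Complex.I * (((n : ℕ) : ℂ) / (L : ℂ))).im = 2 * Real.pi * n / L := by
    simp [Complex.mul_im, Complex.div_re, Complex.div_im]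
    field_simp
  rw [hre, him, Real.exp_zero, one_mul]

/-- `e^{iq·eₓ} + e^{iq·(−eₓ)} = 2cos(2π val(q₁)/L)`. [folklore] -/
theorem phase_ex_add_neg (q : Tor L) :
    phase L q (ex L) + phase L q (-ex L) = ((2 * Real.cos (2 * Real.pi * q.1.val / L) : ℝ) : ℂ) := by
  rw [← conj_phase, phase_ex, exp_add_conj_eq_two_cos]

/-- `e^{iq·e_y} + e^{iq·(−e_y)} = 2cos(2π val(q₂)/L)`. [folklore] -/
theorem phase_ey_add_neg (q : Tor L) :
    phase L q (ey L) + phase L q (-ey L) = ((2 * Real.cos (2 * Real.pi * q.2.val / L) : ℝ) : ℂ) := by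
  rw [← conj_phase, phase_ey, exp_add_conj_eq_two_cos]

/-- `Σ_{e = ±eₓ, ±e_y} e^{iq·e} = 4 − 2ε(q)`. [folklore] -/
theorem sum_phase_nn (q : Tor L) :
    phase L q (ex L) + phase L q (-ex L) + phase L q (ey L) + phase L q (-ey L)
      = ((4 - 2 * epsT L q : ℝ) : ℂ) := by
  rw [phase_ex_add_neg, add_assoc, phase_ey_add_neg, ← Complex.ofReal_add]
  congr 1; unfold epsT; ring

/-! ## Plane waves -/

/-- the plane wave `e^{ik₂·a} e^{ik₃·b}` of the fibre (momenta of particles 2 and 3; particle 1 carries `K − k₂ − k₃`). [folklore] -/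
def pw (k₂ k₃ : Tor L) : Cfg L → ℂ := fun c => phase L k₂ c.1 * phase L k₃ c.2

/-- one hopping triple on a plane wave: `hopT e = pw · (e^{ik₂·e} + e^{ik₃·e} + e^{i(K−k₂−k₃)·e})`. [folklore] -/
theorem hopT_pw (K k₂ k₃ : Tor L) (c : Cfg L) (e : Tor L) :
    hopT L K (pw L k₂ k₃) c e
      = pw L k₂ k₃ c * (phase L k₂ e + phase L k₃ e + phase L (K - k₂ - k₃) e) := by
  unfold hopT pw
  simp only
  rw [phase_add, phase_add]
  have h3 : phase L K e * (phase L k₂ (c.1 - e) * phase L k₃ (c.2 - e))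
      = phase L k₂ c.1 * phase L k₃ c.2 * phase L (K - k₂ - k₃) e := by
    have e2 : phase L k₂ (c.1 - e) = phase L k₂ c.1 * phase L k₂ (-e) := by
      rw [← phase_add, sub_eq_add_neg]
    have e3 : phase L k₃ (c.2 - e) = phase L k₃ c.2 * phase L k₃ (-e) := by
      rw [← phase_add, sub_eq_add_neg]
    have eK : phase L (K - k₂ - k₃) e = phase L K e * (phase L k₂ (-e) * phase L k₃ (-e)) := by
      rw [← phase_neg_left, ← phase_neg_left, ← phase_add_left, ← phase_add_left]
      congr 1; abel
    rw [e2, e3, eK]; ring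
  rw [h3]; ring

/-- **Plane waves diagonalise the free fibre Hamiltonian:** `H₀(K) pw_{k₂k₃} = [ε(K−k₂−k₃) + ε(k₂) + ε(k₃)] pw_{k₂k₃}`.
[folklore] -/
theorem H0apply_pw (K k₂ k₃ : Tor L) (c : Cfg L) :
    H0apply L K (pw L k₂ k₃) c
      = ((epsT L (K - k₂ - k₃) + epsT L k₂ + epsT L k₃ : ℝ) : ℂ) * pw L k₂ k₃ c := by
  rw [H0apply_four, hopT_pw, hopT_pw, hopT_pw, hopT_pw]
  have key : (phase L k₂ (ex L) + phase L k₃ (ex L) + phase L (K - k₂ - k₃) (ex L))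
      + (phase L k₂ (-ex L) + phase L k₃ (-ex L) + phase L (K - k₂ - k₃) (-ex L))
      + (phase L k₂ (ey L) + phase L k₃ (ey L) + phase L (K - k₂ - k₃) (ey L))
      + (phase L k₂ (-ey L) + phase L k₃ (-ey L) + phase L (K - k₂ - k₃) (-ey L))
      = ((4 - 2 * epsT L k₂ : ℝ) : ℂ) + ((4 - 2 * epsT L k₃ : ℝ) : ℂ) + ((4 - 2 * epsT L (K - k₂ - k₃) : ℝ) : ℂ) := by
    rw [← sum_phase_nn, ← sum_phase_nn, ← sum_phase_nn]; ring
  have : (6 : ℂ) * pw L k₂ k₃ c - 1 / 2 *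
      (pw L k₂ k₃ c * (phase L k₂ (ex L) + phase L k₃ (ex L) + phase L (K - k₂ - k₃) (ex L))
        + pw L k₂ k₃ c * (phase L k₂ (-ex L) + phase L k₃ (-ex L) + phase L (K - k₂ - k₃) (-ex L))
        + pw L k₂ k₃ c * (phase L k₂ (ey L) + phase L k₃ (ey L) + phase L (K - k₂ - k₃) (ey L))
        + pw L k₂ k₃ c * (phase L k₂ (-ey L) + phase L k₃ (-ey L) + phase L (K - k₂ - k₃) (-ey L)))
      = pw L k₂ k₃ c * (6 - 1 / 2 * ((phase L k₂ (ex L) + phase L k₃ (ex L) + phase L (K - k₂ - k₃) (ex L))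
      + (phase L k₂ (-ex L) + phase L k₃ (-ex L) + phase L (K - k₂ - k₃) (-ex L))
      + (phase L k₂ (ey L) + phase L k₃ (ey L) + phase L (K - k₂ - k₃) (ey L))
      + (phase L k₂ (-ey L) + phase L k₃ (-ey L) + phase L (K - k₂ - k₃) (-ey L)))) := by ring
  rw [this, key]
  push_cast
  ring

end Summit.HubbardSuperconductivity.HubbardSuperconductivity.Theorems.AnisotropyChord.Transfer.Fibre3

end
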